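import Summits.NavierStokesRegularity.FunctionalMining.TopEigDensityIdentity
import Literature.Analysis.FunctionSpaces.TorusClassicalNSGluing
import HarnessLib

/-!
# FunctionalMining — the heat dissipation of `∫ λ₁^q` as the integral of the channel density along a
# smooth global top eigenpair (F1 PART I, Corollary 3′ (a))

Search for candidate a priori estimates; no regularity claim. Cell `pub-nsfunc`, prove seat
(gen 22). Integrated form of the density identity (`TopEigDensityIdentity.lean`; F1 PART I
PROPOSITION 3 / COROLLARY 3′ of the no-go seat, pen, countersigned in the cell — not a cited fact).
Let `v` be smooth and divergence free on `T^d`, `q ≥ 1`, and let `(μ, e)` be a smooth global unit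
eigenpair of `S = sym ∇v` with `e(x)` a TOP vector everywhere (so `μ = λ₁`) and `μ > 0` everywhere.
Put `∂ₖe := (∂ₖeᵢ)ᵢ` and

  `F(x) := q(q−1) μ^{q−2} ∑ₖ (∂ₖμ)² + 2q μ^{q−1} ∑ₖ (μ |∂ₖe|² − (∂ₖe)ᵀ S ∂ₖe)`   (`≥ 0` termwise),

the basis-free form of SIEVELD's density (1) ("grad-λ" + "rotation/tilt" channels). Then

* `TopEig.laplacian_rpow_of_pos` — `Δ(μ^q) = q(q−1) μ^{q−2} |∇μ|² + q μ^{q−1} Δμ` for smooth `μ > 0`;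
* `TopEig.neg_integral_selectionDensity_eq` — `−∫ q λ₁^{q−1} eᵀ ΔS e = ∫ F` (Prop. 3 pointwise and
  `∫_{T^d} Δ(μ^q) = 0`);
* **`TopEig.heatDissipation_topEigMoment_le_integral_channels`** — `heatDissipation (∫(λ₁⁺)^q) v ≤ ∫ F`
  (Corollary 2's selection bound with the smooth selection `e`);
* **`TopEig.heatDissipation_topEigMoment_eq_integral_channels`** (COROLLARY 3′ (a)) — if moreover `e`
  attains `μ(S; ΔS)` everywhere (automatic where `λ₁` is simple), `heatDissipation (∫(λ₁⁺)^q) v = ∫ F`: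
  the density (1) is EXACT, channel by channel, and `T(v) ≥ 0` is visible termwise.

What is NOT here: the existence of a smooth top eigenpair on `{λ₁ simple}` (implicit function
theorem) and the region-by-region version with boundary fluxes (Cor. 3′ (b), Lemma 6). [ours;
folklore]
-/

noncomputable section

open MeasureTheory Set Filter Topology Matrix

namespace Summit.NavierStokesRegularity.FunctionalMining

open Literature.Analysis Literature.Analysis.FunctionSpaces Literature.Analysis.FunctionSpaces.Torus
  Literature.Analysis.FluidPDE

namespace TopEig

variable {d : Type*} [Fintype d] [DecidableEq d]

/-! ## 1. Powers of a positive smooth function on the torus -/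

omit [DecidableEq d] in
/-- `μ^q` is smooth for smooth `μ > 0`. [folklore] -/
theorem isSmooth_rpow_of_pos {μ : UnitAddTorus d → ℝ} (hμ : Torus.IsSmooth μ) (hpos : ∀ y, 0 < μ y)
    (q : ℝ) : Torus.IsSmooth (fun y => μ y ^ q) := by
  unfold Torus.IsSmooth at hμ ⊢
  exact hμ.rpow_const_of_ne fun z => (hpos _).ne'

/-- **`∂ₖ∂ₖ(μ^q) = q(q−1) μ^{q−2} (∂ₖμ)² + q μ^{q−1} ∂ₖ∂ₖμ`** for smooth `μ > 0` (one-variable chain rule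
along the coordinate line). [folklore] -/
theorem partialDeriv_partialDeriv_rpow_of_pos {μ : UnitAddTorus d → ℝ} (hμ : Torus.IsSmooth μ)
    (hpos : ∀ y, 0 < μ y) (q : ℝ) (k : d) (x : UnitAddTorus d) :
    Torus.partialDeriv k (Torus.partialDeriv k (fun y => μ y ^ q)) x =
      q * (q - 1) * μ x ^ (q - 2) * Torus.partialDeriv k μ x ^ 2 +
        q * μ x ^ (q - 1) * Torus.partialDeriv k (Torus.partialDeriv k μ) x := by
  set K : EuclideanSpace ℝ d := EuclideanSpace.single k (1 : ℝ) with hK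
  have hμq : Torus.IsSmooth (fun y => μ y ^ q) := isSmooth_rpow_of_pos hμ hpos q
  -- along the line, `∂ₖ(μ^q) = ∂ₖμ · q · μ^{q−1}`
  have hline : ∀ t : ℝ, Torus.partialDeriv k (fun y => μ y ^ q) (x + proj (t • K)) =
      Torus.partialDeriv k μ (x + proj (t • K)) * q * μ (x + proj (t • K)) ^ (q - 1) := fun t =>
    (hasDerivAt_coordLine hμq x k t).unique
      ((hasDerivAt_coordLine hμ x k t).rpow_const (Or.inl (hpos _).ne'))
  -- differentiate once more at `t = 0`
  have h2 : HasDerivAt (fun t : ℝ => Torus.partialDeriv k (fun y => μ y ^ q) (x + proj (t • K)))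
      (Torus.partialDeriv k (Torus.partialDeriv k (fun y => μ y ^ q)) x) 0 := by
    have h := hasDerivAt_coordLine (hμq.partialDeriv k) x k 0
    rw [coordLine_zero] at h
    exact h
  have hg2 : HasDerivAt (fun t : ℝ => Torus.partialDeriv k μ (x + proj (t • K)))
      (Torus.partialDeriv k (Torus.partialDeriv k μ) x) 0 := by
    have h := hasDerivAt_coordLine (hμ.partialDeriv k) x k 0
    rw [coordLine_zero] at h
    exact h
  have hg0 : HasDerivAt (fun t : ℝ => μ (x + proj (t • K))) (Torus.partialDeriv k μ x) 0 := by
    have h := hasDerivAt_coordLine hμ x k 0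
    rw [coordLine_zero] at h
    exact h
  have hpow : HasDerivAt (fun t : ℝ => μ (x + proj (t • K)) ^ (q - 1))
      (Torus.partialDeriv k μ x * (q - 1) * μ (x + proj ((0 : ℝ) • K)) ^ (q - 1 - 1)) 0 :=
    hg0.rpow_const (Or.inl (hpos _).ne')
  have hprod := (hg2.mul_const q).mul hpow
  have hfun : (fun t : ℝ => Torus.partialDeriv k (fun y => μ y ^ q) (x + proj (t • K))) =
      fun t => Torus.partialDeriv k μ (x + proj (t • K)) * q * μ (x + proj (t • K)) ^ (q - 1) :=
    funext hline
  rw [hfun] at h2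
  have h := h2.unique hprod
  rw [h, coordLine_zero, show q - 1 - 1 = q - 2 by ring]
  ring

/-- **`Δ(μ^q) = q(q−1) μ^{q−2} ∑ₖ(∂ₖμ)² + q μ^{q−1} Δμ`** for smooth `μ > 0` on `T^d`. [folklore] -/
theorem laplacian_rpow_of_pos {μ : UnitAddTorus d → ℝ} (hμ : Torus.IsSmooth μ) (hpos : ∀ y, 0 < μ y)
    (q : ℝ) (x : UnitAddTorus d) :
    Torus.laplacian (fun y => μ y ^ q) x =
      q * (q - 1) * μ x ^ (q - 2) * ∑ k, Torus.partialDeriv k μ x ^ 2 +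
        q * μ x ^ (q - 1) * Torus.laplacian μ x := by
  rw [Torus.laplacian_eq_sum_partialDeriv_partialDeriv (isSmooth_rpow_of_pos hμ hpos q),
    Torus.laplacian_eq_sum_partialDeriv_partialDeriv hμ]
  simp_rw [partialDeriv_partialDeriv_rpow_of_pos hμ hpos q _ x]
  rw [Finset.sum_add_distrib, ← Finset.mul_sum, ← Finset.mul_sum]

/-! ## 2. The channel density of a smooth global top eigenpair -/

section Eigenpair

variable [Nonempty d]
variable {v : UnitAddTorus d → EuclideanSpace ℝ d} {e : UnitAddTorus d → d → ℝ} {μ : UnitAddTorus d → ℝ}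

/-- Along a global top eigenpair the eigenvalue is the cell's `λ₁` density `torusStrainTopEig`.
[ours, bookkeeping] -/
theorem torusStrainTopEig_eq_of_top (heig : ∀ y, torusStrainMatrix v y *ᵥ e y = μ y • e y)
    (hunit : ∀ y, e y ⬝ᵥ e y = 1) (htop : ∀ y, e y ∈ topEigSet (StrainL4.strainFlat v y))
    (x : UnitAddTorus d) : torusStrainTopEig v x = μ x := by
  rw [← lam_strainFlat, ← (htop x).2, ← flat_torusStrainMatrix, SharpClass.DirectorForm.quad_flat, heig x,
    dotProduct_smul, hunit x, smul_eq_mul, mul_one]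

omit [Nonempty d] in
/-- Continuity of the selection density `x ↦ q μ^{q−1} e(x)ᵀ ΔS(x) e(x)`. [folklore] -/
theorem continuous_selectionDensity (hv : Torus.IsSmooth v) (he : ∀ i, Torus.IsSmooth (fun y => e y i))
    (hμ : Torus.IsSmooth μ) (hpos : ∀ y, 0 < μ y) (q : ℝ) :
    Continuous fun x => q * μ x ^ (q - 1) * quad (StrainL4.strainFlat (Torus.laplacian v) x) (e x) := by
  have hS : ∀ i j, Continuous fun x => StrainL4.strainFlat (Torus.laplacian v) x (i, j) := fun i j =>
    (EuclideanSpace.proj (i, j) : EuclideanSpace ℝ (d × d) →L[ℝ] ℝ).continuous.comp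
      (StrainL4.isSmooth_strainFlat hv.laplacian).continuous
  have hq : Continuous fun x => quad (StrainL4.strainFlat (Torus.laplacian v) x) (e x) := by
    unfold quad
    exact continuous_finsetSum _ fun i _ => continuous_finsetSum _ fun j _ =>
      (((he i).continuous.mul (hS i j)).mul (he j).continuous)
  exact (continuous_const.mul (hμ.continuous.rpow_const fun x => Or.inl (hpos x).ne')).mul hq

omit [Nonempty d] in
/-- Continuity of the channel density `F`. [folklore] -/
theorem continuous_channelDensity (hv : Torus.IsSmooth v) (he : ∀ i, Torus.IsSmooth (fun y => e y i))
    (hμ : Torus.IsSmooth μ) (hpos : ∀ y, 0 < μ y) (q : ℝ) :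
    Continuous fun x =>
      q * (q - 1) * μ x ^ (q - 2) * ∑ k, Torus.partialDeriv k μ x ^ 2 +
        2 * q * μ x ^ (q - 1) * ∑ k, (μ x * ((fun i => Torus.partialDeriv k (fun y => e y i) x) ⬝ᵥ
            (fun i => Torus.partialDeriv k (fun y => e y i) x)) -
          (fun i => Torus.partialDeriv k (fun y => e y i) x) ⬝ᵥ
            (torusStrainMatrix v x *ᵥ fun i => Torus.partialDeriv k (fun y => e y i) x)) := by
  have hde : ∀ k i, Continuous fun x => Torus.partialDeriv k (fun y => e y i) x := fun k i =>
    ((he i).partialDeriv k).continuous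
  have hdμ : ∀ k, Continuous fun x => Torus.partialDeriv k μ x := fun k => (hμ.partialDeriv k).continuous
  have hSc : ∀ i j, Continuous fun x => torusStrainMatrix v x i j := fun i j =>
    (isSmooth_torusStrainMatrix_entry hv i j).continuous
  have hpw : ∀ r : ℝ, Continuous fun x => μ x ^ r := fun r =>
    hμ.continuous.rpow_const fun x => Or.inl (hpos x).ne'
  have h1 : Continuous fun x => q * (q - 1) * μ x ^ (q - 2) * ∑ k, Torus.partialDeriv k μ x ^ 2 :=
    (continuous_const.mul (hpw _)).mul (continuous_finsetSum _ fun k _ => (hdμ k).pow 2)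
  have hdot : ∀ k, Continuous fun x => (fun i => Torus.partialDeriv k (fun y => e y i) x) ⬝ᵥ
      (fun i => Torus.partialDeriv k (fun y => e y i) x) := fun k => by
    simp only [dotProduct]
    exact continuous_finsetSum _ fun i _ => (hde k i).mul (hde k i)
  have hray : ∀ k, Continuous fun x => (fun i => Torus.partialDeriv k (fun y => e y i) x) ⬝ᵥ
      (torusStrainMatrix v x *ᵥ fun i => Torus.partialDeriv k (fun y => e y i) x) := fun k => by
    simp only [dotProduct_mulVec_eq_sum_sum]
    exact continuous_finsetSum _ fun i _ => continuous_finsetSum _ fun j _ =>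
      ((hde k i).mul (hSc i j)).mul (hde k j)
  have h2 : Continuous fun x => 2 * q * μ x ^ (q - 1) * ∑ k,
      (μ x * ((fun i => Torus.partialDeriv k (fun y => e y i) x) ⬝ᵥ
          (fun i => Torus.partialDeriv k (fun y => e y i) x)) -
        (fun i => Torus.partialDeriv k (fun y => e y i) x) ⬝ᵥ
          (torusStrainMatrix v x *ᵥ fun i => Torus.partialDeriv k (fun y => e y i) x)) :=
    (continuous_const.mul (hpw _)).mul
      (continuous_finsetSum _ fun k _ => (hμ.continuous.mul (hdot k)).sub (hray k))
  exact h1.add h2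

/-- **`−∫ q λ₁^{q−1} eᵀ ΔS e = ∫ F`** along a smooth global top eigenpair with `μ = λ₁ > 0`
(Proposition 3 pointwise, `Δ(μ^q) = q(q−1)μ^{q−2}|∇μ|² + qμ^{q−1}Δμ`, and `∫_{T^d} Δ(μ^q) = 0`).
[ours; F1 PART I Prop. 3 / Cor. 3′] -/
theorem neg_integral_selectionDensity_eq (hv : Torus.IsSmooth v)
    (he : ∀ i, Torus.IsSmooth (fun y => e y i))
    (heig : ∀ y, torusStrainMatrix v y *ᵥ e y = μ y • e y) (hunit : ∀ y, e y ⬝ᵥ e y = 1)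
    (htop : ∀ y, e y ∈ topEigSet (StrainL4.strainFlat v y)) (hpos : ∀ y, 0 < μ y) (q : ℝ) :
    -∫ x, q * torusStrainTopEig v x ^ (q - 1) * quad (StrainL4.strainFlat (Torus.laplacian v) x) (e x) =
      ∫ x, (q * (q - 1) * μ x ^ (q - 2) * ∑ k, Torus.partialDeriv k μ x ^ 2 +
        2 * q * μ x ^ (q - 1) * ∑ k, (μ x * ((fun i => Torus.partialDeriv k (fun y => e y i) x) ⬝ᵥ
            (fun i => Torus.partialDeriv k (fun y => e y i) x)) -
          (fun i => Torus.partialDeriv k (fun y => e y i) x) ⬝ᵥ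
            (torusStrainMatrix v x *ᵥ fun i => Torus.partialDeriv k (fun y => e y i) x))) := by
  have hμs : Torus.IsSmooth μ := isSmooth_eigenvalue hv he heig hunit
  have hμq : Torus.IsSmooth (fun y => μ y ^ q) := isSmooth_rpow_of_pos hμs hpos q
  have hF := (continuous_channelDensity hv he hμs hpos q).integrable_unitAddTorus
  have hL := hμq.laplacian.integrable
  -- pointwise identity: `−q λ₁^{q−1} eᵀΔS e = F − Δ(μ^q)`
  have hpt : ∀ x, -(q * torusStrainTopEig v x ^ (q - 1) *
      quad (StrainL4.strainFlat (Torus.laplacian v) x) (e x)) =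
      (q * (q - 1) * μ x ^ (q - 2) * ∑ k, Torus.partialDeriv k μ x ^ 2 +
        2 * q * μ x ^ (q - 1) * ∑ k, (μ x * ((fun i => Torus.partialDeriv k (fun y => e y i) x) ⬝ᵥ
            (fun i => Torus.partialDeriv k (fun y => e y i) x)) -
          (fun i => Torus.partialDeriv k (fun y => e y i) x) ⬝ᵥ
            (torusStrainMatrix v x *ᵥ fun i => Torus.partialDeriv k (fun y => e y i) x))) -
        Torus.laplacian (fun y => μ y ^ q) x := by
    intro x
    rw [torusStrainTopEig_eq_of_top heig hunit htop x, quad_strainFlat_laplacian_eq hv he heig hunit x,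
      laplacian_rpow_of_pos hμs hpos q x]
    ring
  rw [← integral_neg]
  simp_rw [hpt]
  rw [integral_sub hF hL, integral_laplacian_eq_zero_of_isSmooth hμq, sub_zero]

/-- **Selection bound with the channel density (F1 PART I, Cor. 2 + Prop. 3).** For smooth
divergence-free `v`, `q ≥ 1`, and a smooth global unit eigenpair `S e = μ e` with `e(x)` a top vector
and `μ(x) > 0` everywhere:
`heatDissipation (∫(λ₁⁺)^q) v ≤ ∫ [q(q−1)μ^{q−2}|∇μ|² + 2qμ^{q−1}∑ₖ(μ|∂ₖe|² − (∂ₖe)ᵀS∂ₖe)]`,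
an integral of non-negative channels. [ours; F1 PART I Cor. 3′] -/
theorem heatDissipation_topEigMoment_le_integral_channels {q : ℝ} (hq : 1 ≤ q) (hv : Torus.IsSmooth v)
    (hdiv : Torus.IsDivFree v) (he : ∀ i, Torus.IsSmooth (fun y => e y i))
    (heig : ∀ y, torusStrainMatrix v y *ᵥ e y = μ y • e y) (hunit : ∀ y, e y ⬝ᵥ e y = 1)
    (htop : ∀ y, e y ∈ topEigSet (StrainL4.strainFlat v y)) (hpos : ∀ y, 0 < μ y) :
    heatDissipation (torusTopEigMoment q) v ≤
      ∫ x, (q * (q - 1) * μ x ^ (q - 2) * ∑ k, Torus.partialDeriv k μ x ^ 2 +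
        2 * q * μ x ^ (q - 1) * ∑ k, (μ x * ((fun i => Torus.partialDeriv k (fun y => e y i) x) ⬝ᵥ
            (fun i => Torus.partialDeriv k (fun y => e y i) x)) -
          (fun i => Torus.partialDeriv k (fun y => e y i) x) ⬝ᵥ
            (torusStrainMatrix v x *ᵥ fun i => Torus.partialDeriv k (fun y => e y i) x))) := by
  have hμs : Torus.IsSmooth μ := isSmooth_eigenvalue hv he heig hunit
  have hint : Integrable (fun x => q * torusStrainTopEig v x ^ (q - 1) *
      quad (StrainL4.strainFlat (Torus.laplacian v) x) (e x)) volume := by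
    have h := (continuous_selectionDensity hv he hμs hpos q).integrable_unitAddTorus
    refine h.congr (ae_of_all _ fun x => ?_)
    simp only [torusStrainTopEig_eq_of_top heig hunit htop x]
  rw [← neg_integral_selectionDensity_eq hv he heig hunit htop hpos q]
  exact heatDissipation_topEigMoment_le_of_selection hq hv hdiv (ae_of_all _ htop) hint

/-- **COROLLARY 3′ (a) of F1 PART I (the density is exact along an attaining top eigenpair).** If in
addition `e(x)` attains `μ(S(x); ΔS(x))` everywhere (automatic wherever `λ₁` is simple), then
`heatDissipation (∫(λ₁⁺)^q) v = ∫ [q(q−1)μ^{q−2}|∇μ|² + 2qμ^{q−1}∑ₖ(μ|∂ₖe|² − (∂ₖe)ᵀS∂ₖe)]`: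
SIEVELD's density (1) is exact channel by channel, and `T(v) ≥ 0` termwise. [ours; F1 PART I Cor. 3′] -/
theorem heatDissipation_topEigMoment_eq_integral_channels {q : ℝ} (hq : 1 ≤ q) (hv : Torus.IsSmooth v)
    (hdiv : Torus.IsDivFree v) (he : ∀ i, Torus.IsSmooth (fun y => e y i))
    (heig : ∀ y, torusStrainMatrix v y *ᵥ e y = μ y • e y) (hunit : ∀ y, e y ⬝ᵥ e y = 1)
    (htop : ∀ y, e y ∈ topEigSet (StrainL4.strainFlat v y)) (hpos : ∀ y, 0 < μ y)
    (hattain : ∀ y, dirTopEig (StrainL4.strainFlat v y) (StrainL4.strainFlat (Torus.laplacian v) y) =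
      quad (StrainL4.strainFlat (Torus.laplacian v) y) (e y)) :
    heatDissipation (torusTopEigMoment q) v =
      ∫ x, (q * (q - 1) * μ x ^ (q - 2) * ∑ k, Torus.partialDeriv k μ x ^ 2 +
        2 * q * μ x ^ (q - 1) * ∑ k, (μ x * ((fun i => Torus.partialDeriv k (fun y => e y i) x) ⬝ᵥ
            (fun i => Torus.partialDeriv k (fun y => e y i) x)) -
          (fun i => Torus.partialDeriv k (fun y => e y i) x) ⬝ᵥ
            (torusStrainMatrix v x *ᵥ fun i => Torus.partialDeriv k (fun y => e y i) x))) := by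
  rw [heatDissipation_topEigMoment_eq_integral hq hv hdiv,
    ← neg_integral_selectionDensity_eq hv he heig hunit htop hpos q]
  simp_rw [hattain]

omit [Nonempty d] in
/-- **Each channel term is non-negative** along a top eigenpair (so the integrand of Cor. 3′ is
`≥ 0` for `q ≥ 1`, `μ ≥ 0`): `μ|∂ₖe|² − (∂ₖe)ᵀ S ∂ₖe ≥ 0`. [ours] -/
theorem channel_nonneg_of_top (hv : Torus.IsSmooth v) (he : ∀ i, Torus.IsSmooth (fun y => e y i))
    (heig : ∀ y, torusStrainMatrix v y *ᵥ e y = μ y • e y) (hunit : ∀ y, e y ⬝ᵥ e y = 1)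
    (htop : ∀ y, e y ∈ topEigSet (StrainL4.strainFlat v y)) (k : d) (x : UnitAddTorus d) :
    0 ≤ μ x * ((fun i => Torus.partialDeriv k (fun y => e y i) x) ⬝ᵥ
        (fun i => Torus.partialDeriv k (fun y => e y i) x)) -
      (fun i => Torus.partialDeriv k (fun y => e y i) x) ⬝ᵥ
        (torusStrainMatrix v x *ᵥ fun i => Torus.partialDeriv k (fun y => e y i) x) := by
  rw [← eigenpair_channel_partialDeriv hv he heig hunit k x]
  exact eigenpair_channel_partialDeriv_nonneg hv he heig hunit k (htop x)

end Eigenpair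

end TopEig

end Summit.NavierStokesRegularity.FunctionalMining

end
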